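import Mathlib.MeasureTheory.Integral.Bochner.Basic
import Mathlib.MeasureTheory.Integral.Bochner.Set
import Mathlib.MeasureTheory.Measure.Lebesgue.Basic
import Mathlib.Analysis.SpecialFunctions.Exp

/-!
# Crux `ChessboardParticlePlanes.LjPlaneChessboard` (stmt-AtomisticToContinuum-6709), line `Sketch` —
# transport of a slice certificate across cross-plane offsets

The cross-plane Lennard-Jones multiplier at in-plane wavenumber `q` and vertical offset `u` is a
Laplace transform `K_q(u) = ∫_S W_q(λ) e^{−λu} dλ` of a slice weight `W_q` with ONE sign change:
`W_q(λ) ≥ 0` for `λ ≤ λ*` and `W_q(λ) ≤ 0` for `λ ≥ λ*` (`λ* = λ*(q) = √(q² + 67.07)`, the Yukawa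
masses `m > 302400^{1/6}` of the repulsion).  Consequences proved here, for an abstract weight:

* `setIntegral_mul_exp_transport_mono` — `u ↦ e^{λ* u} K(u)` is non-decreasing: pointwise,
  `W(λ) (e^{(λ*−λ)u} − e^{(λ*−λ)u₀}) ≥ 0` in both sign regimes;
* `sliceTransport` — hence a certificate value `η ≤ K(u₀)` at the corner offset `u₀` transports to
  every `u ≥ u₀` with a `q`-INDEPENDENT rate `l₀`:  `e^{−l₀(u−u₀)} η ≤ K(u)`, provided
  `η ≤ 0 ∧ l₀ ≤ λ*` (the anti-reflection-positive columns) or `0 ≤ η ∧ λ* ≤ l₀` (the columns where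
  the certificate is positive).  This is why ONE radial certificate at offset `3/2` serves all
  second-neighbour offsets `u ≥ 3/2` of the layered configuration.

[folklore; elementary real analysis, recorded for the certificate architecture of `stub_deficitCore`]
-/

noncomputable section

namespace Summit.AtomisticToContinuum.Crystallization.Theorems.ChessboardParticlePlanesLjPlaneChessboard

open MeasureTheory Set Real

/-- Pointwise monotonicity behind the transport: if `W ≥ 0` below `lS` and `W ≤ 0` above, then for
`u₀ ≤ u`, `W(λ) e^{(lS−λ) u₀} ≤ W(λ) e^{(lS−λ) u}`. [folklore] -/
theorem mul_exp_transport_pointwise {W : ℝ → ℝ} {lS u₀ u l : ℝ} (huv : u₀ ≤ u)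
    (hW : (l ≤ lS → 0 ≤ W l) ∧ (lS ≤ l → W l ≤ 0)) :
    W l * Real.exp ((lS - l) * u₀) ≤ W l * Real.exp ((lS - l) * u) := by
  rcases le_total l lS with hl | hl
  · have hWl : 0 ≤ W l := hW.1 hl
    have hmono : Real.exp ((lS - l) * u₀) ≤ Real.exp ((lS - l) * u) :=
      Real.exp_le_exp.2 (mul_le_mul_of_nonneg_left huv (sub_nonneg.2 hl))
    exact mul_le_mul_of_nonneg_left hmono hWl
  · have hWl : W l ≤ 0 := hW.2 hl
    have hmono : Real.exp ((lS - l) * u) ≤ Real.exp ((lS - l) * u₀) :=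
      Real.exp_le_exp.2 (mul_le_mul_of_nonpos_left huv (sub_nonpos.2 hl))
    exact mul_le_mul_of_nonpos_left hmono hWl

/-- **Monotone transport of a one-sign-change Laplace transform.**  If `W ≥ 0` on `S ∩ {λ ≤ lS}` and
`W ≤ 0` on `S ∩ {lS ≤ λ}`, then for `u₀ ≤ u` (both integrands integrable on `S`)
`e^{lS u₀} ∫_S W(λ) e^{−λ u₀} dλ ≤ e^{lS u} ∫_S W(λ) e^{−λ u} dλ`. [folklore] -/
theorem setIntegral_mul_exp_transport_mono {W : ℝ → ℝ} {S : Set ℝ} {lS u₀ u : ℝ} (huv : u₀ ≤ u)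
    (hW : ∀ l ∈ S, (l ≤ lS → 0 ≤ W l) ∧ (lS ≤ l → W l ≤ 0)) (hS : MeasurableSet S)
    (h₀ : IntegrableOn (fun l => W l * Real.exp (-(l * u₀))) S)
    (h₁ : IntegrableOn (fun l => W l * Real.exp (-(l * u))) S) :
    Real.exp (lS * u₀) * ∫ l in S, W l * Real.exp (-(l * u₀))
      ≤ Real.exp (lS * u) * ∫ l in S, W l * Real.exp (-(l * u)) := by
  rw [← integral_const_mul, ← integral_const_mul]
  have e₀ : ∀ l, Real.exp (lS * u₀) * (W l * Real.exp (-(l * u₀))) = W l * Real.exp ((lS - l) * u₀) := by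
    intro l
    rw [show (lS - l) * u₀ = lS * u₀ + -(l * u₀) by ring, Real.exp_add]
    ring
  have e₁ : ∀ l, Real.exp (lS * u) * (W l * Real.exp (-(l * u))) = W l * Real.exp ((lS - l) * u) := by
    intro l
    rw [show (lS - l) * u = lS * u + -(l * u) by ring, Real.exp_add]
    ring
  simp_rw [e₀, e₁]
  refine setIntegral_mono_on ?_ ?_ hS fun l hl => mul_exp_transport_pointwise huv (hW l hl)
  · exact IntegrableOn.congr_fun (h₀.const_mul (Real.exp (lS * u₀))) (fun l _ => e₀ l) hS
  · exact IntegrableOn.congr_fun (h₁.const_mul (Real.exp (lS * u))) (fun l _ => e₁ l) hS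

/-- **Slice transport of a certificate value (registered sub-goal of `stub_deficitCore`).**
Let `K(v) = ∫_S W(λ) e^{−λ v} dλ` with `W ≥ 0` on `S ∩ {λ ≤ lS}`, `W ≤ 0` on `S ∩ {lS ≤ λ}`
(integrable at `v = u₀` and `v = u`, `u₀ ≤ u`), and let `η ≤ K(u₀)`.  If either `η ≤ 0` and
`l₀ ≤ lS`, or `0 ≤ η` and `lS ≤ l₀`, then `e^{−l₀ (u − u₀)} η ≤ K(u)`.
(From the monotone transport: `K(u) ≥ e^{−lS(u−u₀)} K(u₀) ≥ e^{−lS(u−u₀)} η`, and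
`e^{−lS(u−u₀)} η ≥ e^{−l₀(u−u₀)} η` in both cases.) [folklore] -/
theorem sliceTransport :
    ∀ (W : ℝ → ℝ) (S : Set ℝ) (lS l₀ u₀ u η : ℝ), MeasurableSet S → u₀ ≤ u →
      (∀ l ∈ S, (l ≤ lS → 0 ≤ W l) ∧ (lS ≤ l → W l ≤ 0)) →
      MeasureTheory.IntegrableOn (fun l => W l * Real.exp (-(l * u₀))) S →
      MeasureTheory.IntegrableOn (fun l => W l * Real.exp (-(l * u))) S →
      η ≤ ∫ l in S, W l * Real.exp (-(l * u₀)) →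
      (η ≤ 0 ∧ l₀ ≤ lS) ∨ (0 ≤ η ∧ lS ≤ l₀) →
      Real.exp (-(l₀ * (u - u₀))) * η ≤ ∫ l in S, W l * Real.exp (-(l * u)) := by
  intro W S lS l₀ u₀ u η hS huv hW h₀ h₁ hη hcase
  have hmono := setIntegral_mul_exp_transport_mono huv hW hS h₀ h₁
  set K₀ := ∫ l in S, W l * Real.exp (-(l * u₀)) with hK₀
  set K₁ := ∫ l in S, W l * Real.exp (-(l * u)) with hK₁
  -- K₁ ≥ e^{-lS (u-u₀)} K₀
  have hstep : Real.exp (-(lS * (u - u₀))) * K₀ ≤ K₁ := by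
    have hpos : 0 < Real.exp (lS * u) := Real.exp_pos _
    have : Real.exp (-(lS * (u - u₀))) * K₀ = (Real.exp (lS * u))⁻¹ * (Real.exp (lS * u₀) * K₀) := by
      rw [← mul_assoc, ← Real.exp_neg, ← Real.exp_add,
        show -(lS * (u - u₀)) = -(lS * u) + lS * u₀ by ring]
    rw [this, inv_mul_le_iff₀ hpos]
    exact hmono
  -- e^{-lS Δ} η ≤ e^{-lS Δ} K₀
  have hΔ : 0 ≤ u - u₀ := sub_nonneg.2 huv
  have hstep2 : Real.exp (-(lS * (u - u₀))) * η ≤ Real.exp (-(lS * (u - u₀))) * K₀ :=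
    mul_le_mul_of_nonneg_left hη (Real.exp_pos _).le
  -- e^{-l₀ Δ} η ≤ e^{-lS Δ} η in both cases
  have hstep3 : Real.exp (-(l₀ * (u - u₀))) * η ≤ Real.exp (-(lS * (u - u₀))) * η := by
    rcases hcase with ⟨hη0, hl⟩ | ⟨hη0, hl⟩
    · have : Real.exp (-(lS * (u - u₀))) ≤ Real.exp (-(l₀ * (u - u₀))) :=
        Real.exp_le_exp.2 (by nlinarith)
      exact mul_le_mul_of_nonpos_right this hη0
    · have : Real.exp (-(l₀ * (u - u₀))) ≤ Real.exp (-(lS * (u - u₀))) :=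
        Real.exp_le_exp.2 (by nlinarith)
      exact mul_le_mul_of_nonneg_right this hη0
  linarith
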